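import Literature.MathematicalPhysics.QuantumManyBody.GroundStateFeynmanKacSemigroup
import Literature.Probability.Process.BrownianTimeReversal
import Mathlib.MeasureTheory.Group.LIntegral
import HarnessLib

/-!
# Ground-state Feynman–Kac: symmetry of the Feynman–Kac semigroup by time reversal

Topic `Literature/MathematicalPhysics/QuantumManyBody`; theorems only (no new definition, no named
fact). Step of the proof of the named fact
`Literature.MathematicalPhysics.QuantumManyBody.BoseGas.GroundStateFeynmanKac`: the killed,
interaction-weighted functional `T_t = fkSemigroup v L t` is **symmetric** with respect to
Lebesgue measure,

  `∫ f · T_t g dX = ∫ g · T_t f dX`   for measurable `f, g ≥ 0`   (`lintegral_mul_fkSemigroup_comm`),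

the path-space form of the symmetry of the kernel `u_t(x, y)` of Chung–Zhao (1995), Thm 3.10 and
Thm 3.17 ("possesses a symmetric density kernel"; "the symmetry of `T_t` is far from obvious",
Notes to §3), there derived from Hunt's theorem on the symmetry of `p^D(t; x, y)` (Thm 2.4).
Here it is proved directly on path space: after exchanging the `dX` and `dW` integrals and
translating `X` by the Gaussian displacement `√2 b_t(ω)` (translation invariance of Lebesgue
measure on `(ℝ³)^N`), the weight seen from the endpoint is the weight of the TIME-REVERSED
world-lines `Y + √2 (b_{t-s} - b_t)`, and the family of reversed Brownian paths has the law of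
the family of Brownian paths (`IsPreBrownianReal.reverse` of the tree, coordinate-wise, and
uniqueness of the law on path space) — read, as in `GroundStateFeynmanKacSemigroup.lean`,
through the raw-path functionals (regularisation `pathRegularize`, the identity on continuous
paths).

* `map_pathsRev_eq` — the family of reversed paths has law `wienerPaths N`;
* `raw_worldLine_pathsRev`, `rawWeight_pathsRev` — on the reversed paths, started from `Y`, the
  raw world-line at time `r ≤ t` is the world-line started from `Y - √2 b_t` at time `t - r`, and
  the raw weight is the weight of the world-lines started from `Y - √2 b_t` (reflection
  invariance of `∫₀ᵗ` and of "for all times in `[0, t]`");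
* `lintegral_fkWeight_sub_displacement` — `E[w_t(Y - √2 b_t, ω) f(Y - √2 b_t)] = (T_t f)(Y)`;
* `lintegral_mul_fkSemigroup_comm` — the symmetry.

## References

* K. L. Chung, Z. Zhao, *From Brownian Motion to Schrödinger's Equation* (1995), Thm 2.4
  (Hunt), Thm 3.10, Thm 3.17 and the Notes to Ch. 3. [ChungZhao1995]
* D. Revuz, M. Yor, *Continuous Martingales and Brownian Motion* (1999), Ch. I Ex. (1.11)
  (reversal invariance of Brownian motion).
-/

noncomputable section

namespace Literature.MathematicalPhysics.QuantumManyBody.BoseGas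

open MeasureTheory ProbabilityTheory Filter Set
open scoped ENNReal NNReal Topology
open Literature.Probability.Process

variable {N : ℕ}

/-! ### The reversed paths and their law -/

/-- The reversed-path map `ω ↦ ((b_{t-u} + b_{t ∨ u} - 2 b_t)(ω i k))_{u, i, k}` (on `[0, t]`:
`b_{t-u} - b_t`) is measurable. [folklore] -/
theorem measurable_pathsRev (N : ℕ) (t : ℝ≥0) :
    Measurable fun (ω : PathSpace N) (i : Fin N) (k : Fin 3) (u : ℝ≥0) =>
      brownian (t - u) (ω i k) + brownian (max t u) (ω i k) - 2 * brownian t (ω i k) := by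
  refine measurable_pi_lambda _ fun i => measurable_pi_lambda _ fun k =>
    measurable_pi_lambda _ fun u => ?_
  exact (measurable_reverse measurable_brownian t u).comp
    ((measurable_pi_apply k).comp (measurable_pi_apply i))

/-- **The reversed path of the canonical Brownian motion has the pre-Wiener law** (it is a
pre-Brownian motion with measurable marginals, `IsPreBrownianReal.reverse`; uniqueness of the law
on path space, `IsPreBrownianReal.map_path_eq`). [folklore] -/
theorem map_rev_preWienerMeasure (t : ℝ≥0) :
    preWienerMeasure.map (fun (η : ℝ≥0 → ℝ) (u : ℝ≥0) =>
      brownian (t - u) η + brownian (max t u) η - 2 * brownian t η) = preWienerMeasure := by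
  have h := IsPreBrownianReal.map_path_eq
    (Literature.Probability.RandomPlanarGeometry.isPreBrownianReal_brownian.reverse t)
    Literature.Probability.RandomPlanarGeometry.isPreBrownianReal_brownian
    (fun u => measurable_reverse measurable_brownian t u) measurable_brownian
  exact h.trans map_path_preWienerMeasure

/-- **The family of reversed paths has law `wienerPaths N`** (coordinate-wise
`map_rev_preWienerMeasure`, through `Measure.pi_map_pi` twice). [folklore] -/
theorem map_pathsRev_eq (N : ℕ) (t : ℝ≥0) :
    (wienerPaths N).map (fun (ω : PathSpace N) (i : Fin N) (k : Fin 3) (u : ℝ≥0) =>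
      brownian (t - u) (ω i k) + brownian (max t u) (ω i k) - 2 * brownian t (ω i k)) =
      wienerPaths N := by
  haveI := Literature.Probability.RandomPlanarGeometry.isProbabilityMeasure_preWienerMeasure'
  have hm1 : Measurable fun (η : ℝ≥0 → ℝ) (u : ℝ≥0) =>
      brownian (t - u) η + brownian (max t u) η - 2 * brownian t η :=
    measurable_pi_lambda _ fun u => measurable_reverse measurable_brownian t u
  have h3 : (Measure.pi fun _ : Fin 3 => preWienerMeasure).map
      (fun (η : Fin 3 → ℝ≥0 → ℝ) (k : Fin 3) (u : ℝ≥0) =>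
        brownian (t - u) (η k) + brownian (max t u) (η k) - 2 * brownian t (η k)) =
      Measure.pi fun _ : Fin 3 => preWienerMeasure := by
    rw [Measure.pi_map_pi (fun _ => hm1.aemeasurable)]
    simp_rw [map_rev_preWienerMeasure]
  conv_rhs => rw [wienerPaths]
  rw [wienerPaths, Measure.pi_map_pi (f := fun (_ : Fin N) (η : Fin 3 → ℝ≥0 → ℝ) (k : Fin 3)
    (u : ℝ≥0) => brownian (t - u) (η k) + brownian (max t u) (η k) - 2 * brownian t (η k))
    (fun _ => (measurable_pi_lambda _ fun k => hm1.comp (measurable_pi_apply k)).aemeasurable)]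
  simp_rw [h3]

/-! ### The raw functionals on the reversed paths -/

/-- The world-lines from `Y - √2 b_t` at time `t - u` are `Y + √2 (b_{t-u} - b_t)`. [folklore] -/
theorem worldLine_sub_displacement (Y : Config N) (ω : PathSpace N) (t u : ℝ≥0) :
    worldLine (Y - fun i => WithLp.toLp 2 (fun k : Fin 3 => Real.sqrt 2 * brownian t (ω i k))) ω u =
      fun i => Y i + WithLp.toLp 2 (fun k : Fin 3 =>
        Real.sqrt 2 * (brownian u (ω i k) - brownian t (ω i k))) := by
  funext i
  simp only [worldLine, Pi.sub_apply]
  have h : (fun k : Fin 3 => Real.sqrt 2 * (brownian u (ω i k) - brownian t (ω i k))) =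
      (fun k => Real.sqrt 2 * brownian u (ω i k)) - fun k => Real.sqrt 2 * brownian t (ω i k) := by
    funext k
    simp only [Pi.sub_apply]
    ring
  rw [h, WithLp.toLp_sub]
  abel

/-- **On the reversed paths, started from `Y`, the raw world-line at time `r ∈ [0, t]` is the
world-line started from `Y - √2 b_t` at time `t - r`.** [folklore] -/
theorem raw_worldLine_pathsRev (Y : Config N) (ω : PathSpace N) {t r : ℝ≥0} (hr : r ≤ t) :
    (fun i : Fin N => Y i + WithLp.toLp 2 (fun k : Fin 3 => Real.sqrt 2 *
      pathRegularize (fun u => brownian (t - u) (ω i k) + brownian (max t u) (ω i k) -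
        2 * brownian t (ω i k)) r)) =
      worldLine (Y - fun i => WithLp.toLp 2 (fun k : Fin 3 => Real.sqrt 2 * brownian t (ω i k)))
        ω (t - r) := by
  rw [raw_worldLine_of_continuous Y
    (w := fun i k u => brownian (t - u) (ω i k) + brownian (max t u) (ω i k) - 2 * brownian t (ω i k))
    (fun i k => continuous_reverse (continuous_brownian _) t), worldLine_sub_displacement]
  funext i
  congr 2
  funext k
  rw [reverse_apply_of_le hr]

/-- Real-time bookkeeping: for `r ∈ [0, t]`, `r⁺ ≤ t` and `((t - r⁺ : ℝ≥0) : ℝ) = t - r`. [folklore] -/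
theorem toNNReal_le_of_mem_Icc {t : ℝ≥0} {r : ℝ} (hr : r ∈ Set.Icc (0 : ℝ) t) :
    r.toNNReal ≤ t := Real.toNNReal_le_iff_le_coe.2 hr.2

/-- Real-time bookkeeping: for `0 ≤ r ≤ t`, `t - r⁺ = (t - r)⁺` in `ℝ≥0`. [folklore] -/
theorem tsub_toNNReal_eq {t : ℝ≥0} {r : ℝ} (hr : r ∈ Set.Icc (0 : ℝ) t) :
    t - r.toNNReal = ((t : ℝ) - r).toNNReal := by
  apply NNReal.eq
  rw [NNReal.coe_sub (toNNReal_le_of_mem_Icc hr), Real.coe_toNNReal _ hr.1,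
    Real.coe_toNNReal _ (sub_nonneg.2 hr.2)]

/-- **Reflection of the survival condition**: staying in the box at the reversed times
`t - r`, `r ∈ [0, t]`, is staying in the box at all times of `[0, t]`. [folklore] -/
theorem forall_Icc_rev_iff (P : ℝ≥0 → Prop) (t : ℝ≥0) :
    (∀ r ∈ Set.Icc (0 : ℝ) t, P (t - r.toNNReal)) ↔ ∀ s ∈ Set.Icc (0 : ℝ) t, P s.toNNReal := by
  constructor
  · intro h s hs
    have h' := h (t - s) ⟨sub_nonneg.2 hs.2, by linarith [hs.1]⟩
    have e : t - ((t : ℝ) - s).toNNReal = s.toNNReal := by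
      rw [tsub_toNNReal_eq ⟨sub_nonneg.2 hs.2, by linarith [hs.1]⟩]
      congr 1
      ring
    rwa [e] at h'
  · intro h r hr
    have h' := h (t - r) ⟨sub_nonneg.2 hr.2, by linarith [hr.1]⟩
    rwa [← tsub_toNNReal_eq hr] at h'

/-- **Reflection invariance of the time integral on `[0, t]`**:
`∫_{(0,t]} φ((t - r)⁺) dr = ∫_{(0,t]} φ(r⁺) dr` (Lebesgue measure on `ℝ` is invariant under
`r ↦ t - r`; the endpoints are null). [folklore] -/
theorem setLIntegral_Ioc_rev (φ : ℝ≥0 → ℝ≥0∞) (t : ℝ≥0) :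
    ∫⁻ r in Set.Ioc (0 : ℝ) t, φ (t - r.toNNReal) = ∫⁻ r in Set.Ioc (0 : ℝ) t, φ r.toNNReal := by
  have h1 : ∫⁻ r in Set.Ioc (0 : ℝ) t, φ (t - r.toNNReal) =
      ∫⁻ r in Set.Ioc (0 : ℝ) t, φ ((t : ℝ) - r).toNNReal := by
    refine setLIntegral_congr_fun measurableSet_Ioc (fun r hr => ?_)
    rw [tsub_toNNReal_eq (Set.Ioc_subset_Icc_self hr)]
  rw [h1, ← lintegral_indicator measurableSet_Ioc, ← lintegral_indicator measurableSet_Ioc,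
    ← lintegral_sub_left_eq_self (μ := (volume : Measure ℝ))
      (fun r => (Set.Ioc (0 : ℝ) t).indicator (fun r => φ r.toNNReal) r) (t : ℝ)]
  have h2 : (fun r : ℝ => (Set.Ioc (0 : ℝ) t).indicator (fun r => φ r.toNNReal) ((t : ℝ) - r)) =
      (Set.Ico (0 : ℝ) t).indicator fun r => φ ((t : ℝ) - r).toNNReal := by
    funext r
    by_cases hr : r ∈ Set.Ico (0 : ℝ) t
    · have hr' : (t : ℝ) - r ∈ Set.Ioc (0 : ℝ) t := ⟨by linarith [hr.2], by linarith [hr.1]⟩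
      rw [Set.indicator_of_mem hr', Set.indicator_of_mem hr]
    · have hr' : (t : ℝ) - r ∉ Set.Ioc (0 : ℝ) t := fun h => hr ⟨by linarith [h.2], by linarith [h.1]⟩
      rw [Set.indicator_of_notMem hr', Set.indicator_of_notMem hr]
  rw [h2, lintegral_indicator measurableSet_Ico, lintegral_indicator measurableSet_Ioc]
  exact setLIntegral_congr Ico_ae_eq_Ioc.symm

/-- **On the reversed paths, started from `Y`, the raw weight on `[0, t]` is the Feynman–Kac
weight of the world-lines started from `Y - √2 b_t`.** [folklore] -/
theorem rawWeight_pathsRev (v : ℝ → ℝ≥0∞) (L : ℝ) (t : ℝ≥0) (Y : Config N) (ω : PathSpace N) :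
    {p : Config N × PathSpace N | ∀ r ∈ Set.Icc (0 : ℝ) t, (fun i : Fin N =>
        p.1 i + WithLp.toLp 2 (fun k : Fin 3 =>
          Real.sqrt 2 * pathRegularize (p.2 i k) r.toNNReal)) ∈ boxN N L}.indicator
      (fun p => expNeg (∫⁻ r in Set.Ioc (0 : ℝ) t,
        interaction v (fun i : Fin N => p.1 i + WithLp.toLp 2 (fun k : Fin 3 =>
          Real.sqrt 2 * pathRegularize (p.2 i k) r.toNNReal))))
      (Y, fun i k u => brownian (t - u) (ω i k) + brownian (max t u) (ω i k) - 2 * brownian t (ω i k)) =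
    fkWeight v L t (Y - fun i => WithLp.toLp 2 (fun k : Fin 3 => Real.sqrt 2 * brownian t (ω i k))) ω := by
  set Z : Config N := Y - fun i => WithLp.toLp 2 (fun k : Fin 3 => Real.sqrt 2 * brownian t (ω i k))
    with hZ
  have hmem : ((Y, fun (i : Fin N) (k : Fin 3) (u : ℝ≥0) =>
      brownian (t - u) (ω i k) + brownian (max t u) (ω i k) - 2 * brownian t (ω i k)) ∈
      {p : Config N × PathSpace N | ∀ r ∈ Set.Icc (0 : ℝ) t, (fun i : Fin N =>
        p.1 i + WithLp.toLp 2 (fun k : Fin 3 =>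
          Real.sqrt 2 * pathRegularize (p.2 i k) r.toNNReal)) ∈ boxN N L}) ↔
      ω ∈ survives L t Z := by
    simp only [Set.mem_setOf_eq, survives]
    rw [← forall_Icc_rev_iff (fun s => worldLine Z ω s ∈ boxN N L) t]
    refine forall₂_congr fun r hr => ?_
    rw [raw_worldLine_pathsRev Y ω (toNNReal_le_of_mem_Icc hr)]
  have hact : (∫⁻ r in Set.Ioc (0 : ℝ) t, interaction v (fun i : Fin N => Y i +
      WithLp.toLp 2 (fun k : Fin 3 => Real.sqrt 2 * pathRegularize
        (fun u => brownian (t - u) (ω i k) + brownian (max t u) (ω i k) - 2 * brownian t (ω i k))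
          r.toNNReal))) = pathAction v t Z ω := by
    rw [pathAction, ← setLIntegral_Ioc_rev (fun s => interaction v (worldLine Z ω s)) t]
    refine setLIntegral_congr_fun measurableSet_Ioc (fun r hr => ?_)
    rw [raw_worldLine_pathsRev Y ω (toNNReal_le_of_mem_Icc (Set.Ioc_subset_Icc_self hr))]
  simp only [fkWeight]
  by_cases hω : ω ∈ survives L t Z
  · rw [Set.indicator_of_mem hω, Set.indicator_of_mem (hmem.2 hω), hact]
  · rw [Set.indicator_of_notMem hω, Set.indicator_of_notMem (fun h => hω (hmem.1 h))]

/-- The endpoint of the reversed raw world-line is the starting point `Y - √2 b_t`. [folklore] -/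
theorem raw_worldLine_pathsRev_self (Y : Config N) (ω : PathSpace N) (t : ℝ≥0) :
    (fun i : Fin N => Y i + WithLp.toLp 2 (fun k : Fin 3 => Real.sqrt 2 *
      pathRegularize (fun u => brownian (t - u) (ω i k) + brownian (max t u) (ω i k) -
        2 * brownian t (ω i k)) t)) =
      Y - fun i => WithLp.toLp 2 (fun k : Fin 3 => Real.sqrt 2 * brownian t (ω i k)) := by
  rw [raw_worldLine_pathsRev Y ω le_rfl, tsub_self, worldLine_zero]

/-! ### The reversal identity and the symmetry -/

/-- **Reversal identity.** Seen from the endpoint, the weighted functional is the Feynman–Kac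
functional: `E[w_t(Y - √2 b_t, ω) · f(Y - √2 b_t)] = (e^{-tH_N} f)(Y)` (the reversed Brownian
family has the Wiener law, `map_pathsRev_eq`, and on it the raw functional is the left-hand
integrand, `rawWeight_pathsRev`). [folklore] -/
theorem lintegral_fkWeight_sub_displacement {v : ℝ → ℝ≥0∞} (hv : Measurable v) (L : ℝ) (t : ℝ≥0)
    {f : Config N → ℝ≥0∞} (hf : Measurable f) (Y : Config N) :
    ∫⁻ ω, fkWeight v L t (Y - fun i => WithLp.toLp 2 (fun k : Fin 3 =>
        Real.sqrt 2 * brownian t (ω i k))) ω *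
      f (Y - fun i => WithLp.toLp 2 (fun k : Fin 3 => Real.sqrt 2 * brownian t (ω i k)))
        ∂wienerPaths N = fkSemigroup v L t f Y := by
  -- the raw functional `H(w) = rawWeight t Y w · f(rawWorldLine Y w t)`
  have hH : Measurable fun w : PathSpace N =>
      {p : Config N × PathSpace N | ∀ r ∈ Set.Icc (0 : ℝ) t, (fun i : Fin N =>
        p.1 i + WithLp.toLp 2 (fun k : Fin 3 =>
          Real.sqrt 2 * pathRegularize (p.2 i k) r.toNNReal)) ∈ boxN N L}.indicator
      (fun p => expNeg (∫⁻ r in Set.Ioc (0 : ℝ) t,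
        interaction v (fun i : Fin N => p.1 i + WithLp.toLp 2 (fun k : Fin 3 =>
          Real.sqrt 2 * pathRegularize (p.2 i k) r.toNNReal)))) (Y, w) *
      f (fun i : Fin N => Y i + WithLp.toLp 2 (fun k : Fin 3 =>
        Real.sqrt 2 * pathRegularize (w i k) t)) :=
    ((measurable_rawWeight N hv L t).comp (measurable_const.prodMk measurable_id)).mul
      (hf.comp ((measurable_rawWorldLine_at' N t).comp (measurable_const.prodMk measurable_id)))
  -- `∫ H(rev ω) dW = ∫ H dW = ∫ H(b ω') dW`
  have h1 := lintegral_map (μ := wienerPaths N) hH (measurable_pathsRev N t)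
  have h2 := lintegral_map (μ := wienerPaths N) hH (measurable_pathsPath N)
  rw [map_pathsRev_eq] at h1
  rw [map_pathsPath_eq] at h2
  simp only [rawWeight_pathsRev, raw_worldLine_pathsRev_self, rawWeight_pathsPath,
    raw_worldLine_pathsPath] at h1 h2
  rw [← h1, h2, fkSemigroup, Real.toNNReal_coe]

/-- Translating the starting point by the Gaussian displacement: the `dX`-integral of
`f(X) w_t(X, ω) g(B_t(X, ω))` equals the `dY`-integral of `f(Y - √2 b_t) w_t(Y - √2 b_t, ω) g(Y)`
(translation invariance of Lebesgue measure on `(ℝ³)^N`). [folklore] -/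
theorem lintegral_translate_displacement (v : ℝ → ℝ≥0∞) (L : ℝ) (t : ℝ≥0)
    (f g : Config N → ℝ≥0∞) (ω : PathSpace N) :
    ∫⁻ X, f X * (fkWeight v L t X ω * g (worldLine X ω t)) =
      ∫⁻ Y, g Y * (fkWeight v L t (Y - fun i => WithLp.toLp 2 (fun k : Fin 3 =>
          Real.sqrt 2 * brownian t (ω i k))) ω *
        f (Y - fun i => WithLp.toLp 2 (fun k : Fin 3 => Real.sqrt 2 * brownian t (ω i k)))) := by
  set c : Config N := fun i => WithLp.toLp 2 (fun k : Fin 3 => Real.sqrt 2 * brownian t (ω i k))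
    with hc
  have hWL : ∀ X : Config N, worldLine X ω t = X + c := fun X => rfl
  rw [← lintegral_add_right_eq_self (μ := (volume : Measure (Config N)))
    (fun X => f X * (fkWeight v L t X ω * g (worldLine X ω t))) (-c)]
  refine lintegral_congr fun Y => ?_
  simp only [hWL, ← sub_eq_add_neg, sub_add_cancel]
  ring

/-- **Symmetry of the Feynman–Kac semigroup.** For measurable `v` and measurable `f, g ≥ 0`,
`∫ f(X) (e^{-tH_N} g)(X) dX = ∫ g(X) (e^{-tH_N} f)(X) dX` (`t ≥ 0`): the functional is symmetric
with respect to Lebesgue measure on `(ℝ³)^N` (time reversal of the world-lines). Chung–Zhao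
(1995), Thm 3.10 / Thm 3.17 (symmetric density kernel `u_t`).
[cite: ChungZhao1995, Thm 3.10 and Thm 3.17] -/
theorem lintegral_mul_fkSemigroup_comm_nnreal {v : ℝ → ℝ≥0∞} (hv : Measurable v) (L : ℝ) (t : ℝ≥0)
    {f g : Config N → ℝ≥0∞} (hf : Measurable f) (hg : Measurable g) :
    ∫⁻ X, f X * fkSemigroup v L t g X = ∫⁻ X, g X * fkSemigroup v L t f X := by
  have hm1 : Measurable (Function.uncurry fun (X : Config N) (ω : PathSpace N) =>
      f X * (fkWeight v L t X ω * g (worldLine X ω t))) :=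
    (hf.comp measurable_fst).mul ((measurable_fkWeight_uncurry hv L t).mul
      (hg.comp (measurable_worldLine_uncurry' t)))
  have hdisp : Measurable fun p : PathSpace N × Config N => p.2 - fun i =>
      WithLp.toLp 2 (fun k : Fin 3 => Real.sqrt 2 * brownian t (p.1 i k)) :=
    measurable_snd.sub (measurable_pi_lambda _ fun i => (WithLp.measurable_toLp 2 _).comp
      (measurable_pi_lambda _ fun k => ((measurable_brownian t).const_mul _).comp
        ((measurable_pi_apply k).comp ((measurable_pi_apply i).comp measurable_fst))))
  have hm2 : Measurable (Function.uncurry fun (ω : PathSpace N) (Y : Config N) =>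
      g Y * (fkWeight v L t (Y - fun i => WithLp.toLp 2 (fun k : Fin 3 =>
          Real.sqrt 2 * brownian t (ω i k))) ω *
        f (Y - fun i => WithLp.toLp 2 (fun k : Fin 3 => Real.sqrt 2 * brownian t (ω i k))))) :=
    (hg.comp measurable_snd).mul (((measurable_fkWeight_uncurry hv L t).comp
      (hdisp.prodMk measurable_fst)).mul (hf.comp hdisp))
  calc ∫⁻ X, f X * fkSemigroup v L t g X
      = ∫⁻ X, ∫⁻ ω, f X * (fkWeight v L t X ω * g (worldLine X ω t)) ∂wienerPaths N := by
        refine lintegral_congr fun X => ?_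
        rw [fkSemigroup, Real.toNNReal_coe, lintegral_const_mul]
        exact (measurable_fkWeight hv L t X).mul (hg.comp (measurable_worldLine X t))
    _ = ∫⁻ ω, ∫⁻ X, f X * (fkWeight v L t X ω * g (worldLine X ω t)) ∂volume ∂wienerPaths N :=
        lintegral_lintegral_swap hm1.aemeasurable
    _ = ∫⁻ ω, ∫⁻ Y, g Y * (fkWeight v L t (Y - fun i => WithLp.toLp 2 (fun k : Fin 3 =>
            Real.sqrt 2 * brownian t (ω i k))) ω *
          f (Y - fun i => WithLp.toLp 2 (fun k : Fin 3 => Real.sqrt 2 * brownian t (ω i k))))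
            ∂volume ∂wienerPaths N := by
        refine lintegral_congr fun ω => ?_
        exact lintegral_translate_displacement v L t f g ω
    _ = ∫⁻ Y, ∫⁻ ω, g Y * (fkWeight v L t (Y - fun i => WithLp.toLp 2 (fun k : Fin 3 =>
            Real.sqrt 2 * brownian t (ω i k))) ω *
          f (Y - fun i => WithLp.toLp 2 (fun k : Fin 3 => Real.sqrt 2 * brownian t (ω i k))))
            ∂wienerPaths N ∂volume :=
        lintegral_lintegral_swap hm2.aemeasurable
    _ = ∫⁻ Y, g Y * fkSemigroup v L t f Y := by
        refine lintegral_congr fun Y => ?_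
        have hdY : Measurable fun ω : PathSpace N => Y - fun i =>
            WithLp.toLp 2 (fun k : Fin 3 => Real.sqrt 2 * brownian t (ω i k)) :=
          hdisp.comp (measurable_id.prodMk measurable_const)
        have hmY : Measurable fun ω : PathSpace N =>
            fkWeight v L t (Y - fun i => WithLp.toLp 2 (fun k : Fin 3 =>
                Real.sqrt 2 * brownian t (ω i k))) ω *
              f (Y - fun i => WithLp.toLp 2 (fun k : Fin 3 => Real.sqrt 2 * brownian t (ω i k))) :=
          ((measurable_fkWeight_uncurry hv L t).comp (hdY.prodMk measurable_id)).mul (hf.comp hdY)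
        rw [lintegral_const_mul _ hmY, lintegral_fkWeight_sub_displacement hv L t hf Y]

/-- **Symmetry of the Feynman–Kac semigroup** (real time `t ≥ 0`). Chung–Zhao (1995), Thm 3.10 /
Thm 3.17. [cite: ChungZhao1995, Thm 3.10 and Thm 3.17] -/
theorem lintegral_mul_fkSemigroup_comm {v : ℝ → ℝ≥0∞} (hv : Measurable v) (L : ℝ) {t : ℝ}
    (ht : 0 ≤ t) {f g : Config N → ℝ≥0∞} (hf : Measurable f) (hg : Measurable g) :
    ∫⁻ X, f X * fkSemigroup v L t g X = ∫⁻ X, g X * fkSemigroup v L t f X := by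
  lift t to ℝ≥0 using ht
  exact lintegral_mul_fkSemigroup_comm_nnreal hv L t hf hg

end Literature.MathematicalPhysics.QuantumManyBody.BoseGas

end
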